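import Literature.Combinatorics.Enumerative.PermanentLaplaceExpansion
import HarnessLib

/-!
# Block Laplace expansion of the permanent along a row partition
(decomposition workshop `decomp-valiant`, lens 6 «restricted-models lifting axis», gen 3; support
kernel for the split of `DecompCycle1.TamePer` into the crux `PerNotSmVP`
(stmt-ValiantsHypothesis-23661) and the lifting residual `TameOrSmLift`
(stmt-ValiantsHypothesis-23662))

`permanent_eq_sum_colFamilies`: for a row partition `rb : ι → κ`,
`per A = ∑_S ∏_k per A[B_k, S_k]`, the sum over families `S : κ → Finset ι` of pairwise disjoint
column sets with `|S_k| = |B_k|` (`colFamilies`), each block factor being the bijection sum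
`bijSum A B_k S_k = ∑_(β : B_k ≃ S_k) ∏_(p ∈ B_k) A p (β p)` (the permanent of the `B_k × S_k`
minor up to an enumeration). This is Minc's Laplace expansion (Ch. 2, Thm. 1.2) iterated over the
blocks; the proof groups permutations `σ` by the image family `k ↦ σ(B_k)` and glues block
bijections (`glue`). Sequel files: `BlockLaplaceCircuit` (the exact-cover polynomial and the
syntactically multilinear circuit), `ExactCoverIndicator`, `BlockLaplaceLift` (the `VP = VNP`
lifting rung). HONEST FRAMING: circuit bookkeeping of published constructions (block Laplace expansion,
Limaye–Srinivasan–Tavenas Lemma 12, Valiant's criterion); nothing here bears on the truth of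
`VP ≠ VNP`.

## References

* [Minc1978] H. Minc, *Permanents*, Addison–Wesley 1978, Ch. 2, Thm. 1.2 (Laplace expansion).
* [LimayeSrinivasanTavenas2025] N. Limaye, S. Srinivasan, S. Tavenas, J. ACM 72 (2025), Art. 26,
  Lemma 12.
* [Burgisser2000] P. Bürgisser, *Completeness and Reduction in Algebraic Complexity Theory*,
  Springer 2000, Def. 2.1, Prop. 2.20, Rem. 2.2.
* [RazYehudayoff2008] R. Raz, A. Yehudayoff, Comput. Complexity 17 (2008), §2.
-/

noncomputable section

namespace Summit.ValiantsHypothesis.ValiantsHypothesis.Theorems.BlockLaplaceExpansion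

open Finset Matrix

section BlockLaplace

variable {ι κ R : Type*} [Fintype ι] [DecidableEq ι] [Fintype κ] [DecidableEq κ] [CommSemiring R]

/-- The rows of block `k` for a row-block map `rb`. [folklore] -/
def blockRows (rb : ι → κ) (k : κ) : Finset ι := univ.filter fun i => rb i = k

omit [DecidableEq ι] [Fintype κ] in
/-- Membership in a row block. [folklore] -/
@[simp] theorem mem_blockRows {rb : ι → κ} {k : κ} {i : ι} : i ∈ blockRows rb k ↔ rb i = k := by
  simp [blockRows]

omit [DecidableEq ι] [Fintype κ] in
/-- Every row lies in its own block. [folklore] -/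
theorem mem_blockRows_self (rb : ι → κ) (i : ι) : i ∈ blockRows rb (rb i) := mem_blockRows.2 rfl

omit [DecidableEq ι] [Fintype κ] in
/-- Distinct blocks are disjoint. [folklore] -/
theorem disjoint_blockRows (rb : ι → κ) {k l : κ} (h : k ≠ l) :
    Disjoint (blockRows rb k) (blockRows rb l) := by
  rw [Finset.disjoint_left]
  intro i hi hi'
  exact h ((mem_blockRows.1 hi).symm.trans (mem_blockRows.1 hi'))

/-- Admissible column families: block `k` receives a column set of the size of the block, and the
column sets are pairwise disjoint. [folklore] -/
def colFamilies (rb : ι → κ) : Finset (κ → Finset ι) :=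
  univ.filter fun S => (∀ k, (S k).card = (blockRows rb k).card) ∧
    ∀ k l, k ≠ l → Disjoint (S k) (S l)

/-- Unfolding `colFamilies`. [folklore] -/
theorem mem_colFamilies {rb : ι → κ} {S : κ → Finset ι} :
    S ∈ colFamilies rb ↔ (∀ k, (S k).card = (blockRows rb k).card) ∧
      ∀ k l, k ≠ l → Disjoint (S k) (S l) := by
  simp [colFamilies]

/-- The sign-free bijection sum `∑_{β : B ≃ S} ∏_{p ∈ B} A p (β p)` (the permanent minor on rows
`B`, columns `S`; zero when `|B| ≠ |S|`). [cite: Minc1978, Ch. 2, §2.1] -/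
def bijSum (A : Matrix ι ι R) (B S : Finset ι) : R := ∑ b : ↥B ≃ ↥S, ∏ p : ↥B, A p (b p)

/-- The family of images of the row blocks under a permutation. [folklore] -/
def imageFamily (rb : ι → κ) (σ : Equiv.Perm ι) : κ → Finset ι :=
  fun k => (blockRows rb k).map σ.toEmbedding

/-- The image family of a permutation is admissible. [folklore] -/
theorem imageFamily_mem (rb : ι → κ) (σ : Equiv.Perm ι) : imageFamily rb σ ∈ colFamilies rb := by
  refine mem_colFamilies.2 ⟨fun k => by simp [imageFamily], fun k l hkl => ?_⟩
  simp only [imageFamily]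
  rw [Finset.disjoint_map]
  exact disjoint_blockRows rb hkl

omit [Fintype ι] [DecidableEq ι] [Fintype κ] [DecidableEq κ] in
/-- Dependent rewriting along an equality of blocks. [folklore] -/
theorem equiv_apply_coe_congr {B S : κ → Finset ι} (β : ∀ k, ↥(B k) ≃ ↥(S k)) {k l : κ}
    (h : k = l) (x : ι) (hx : x ∈ B k) : (β k ⟨x, hx⟩ : ι) = β l ⟨x, h ▸ hx⟩ := by
  subst h; rfl

variable (rb : ι → κ) {S : κ → Finset ι}

/-- Gluing a family of block bijections into one map. [folklore] -/
def glueFun (β : ∀ k, ↥(blockRows rb k) ≃ ↥(S k)) : ι → ι :=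
  fun i => (β (rb i) ⟨i, mem_blockRows_self rb i⟩ : ι)

omit [DecidableEq ι] [Fintype κ] in
/-- The glued map sends block `k` into `S k`. [folklore] -/
theorem glueFun_mem (β : ∀ k, ↥(blockRows rb k) ≃ ↥(S k)) (i : ι) : glueFun rb β i ∈ S (rb i) :=
  (β (rb i) ⟨i, mem_blockRows_self rb i⟩).2

omit [DecidableEq ι] [Fintype κ] in
/-- The glued map restricted to block `k` is `β k`. [folklore] -/
theorem glueFun_eq (β : ∀ k, ↥(blockRows rb k) ≃ ↥(S k)) {k : κ} {i : ι}
    (hi : i ∈ blockRows rb k) : glueFun rb β i = (β k ⟨i, hi⟩ : ι) := by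
  have hk : rb i = k := mem_blockRows.1 hi
  exact equiv_apply_coe_congr β hk i _

omit [DecidableEq ι] [Fintype κ] in
/-- The glued map is injective when the targets are pairwise disjoint. [folklore] -/
theorem glueFun_injective (hS : ∀ k l, k ≠ l → Disjoint (S k) (S l))
    (β : ∀ k, ↥(blockRows rb k) ≃ ↥(S k)) : Function.Injective (glueFun rb β) := by
  intro i j hij
  have hk : rb i = rb j := by
    by_contra hne
    have h1 := glueFun_mem rb β i
    have h2 := glueFun_mem rb β j
    rw [hij] at h1
    exact Finset.disjoint_left.1 (hS _ _ hne) h1 h2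
  have hj : j ∈ blockRows rb (rb i) := mem_blockRows.2 hk.symm
  rw [glueFun_eq rb β hj] at hij
  have h' : (β (rb i) ⟨i, mem_blockRows_self rb i⟩) = β (rb i) ⟨j, hj⟩ := Subtype.ext hij
  exact congrArg Subtype.val ((β (rb i)).injective h')

/-- The glued permutation (bijective since injective on a finite type). [folklore] -/
noncomputable def glue (hS : ∀ k l, k ≠ l → Disjoint (S k) (S l))
    (β : ∀ k, ↥(blockRows rb k) ≃ ↥(S k)) : Equiv.Perm ι :=
  Equiv.ofBijective (glueFun rb β) (Finite.injective_iff_bijective.1 (glueFun_injective rb hS β))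

omit [DecidableEq ι] [Fintype κ] in
/-- Unfolding `glue`. [folklore] -/
@[simp] theorem glue_apply (hS : ∀ k l, k ≠ l → Disjoint (S k) (S l))
    (β : ∀ k, ↥(blockRows rb k) ≃ ↥(S k)) (i : ι) : glue rb hS β i = glueFun rb β i := rfl

omit [DecidableEq ι] [Fintype κ] in
/-- A permutation in the fibre of `S` maps block `k` onto `S k`. [folklore] -/
theorem mem_iff_of_imageFamily_eq {σ : Equiv.Perm ι} (h : imageFamily rb σ = S) (k : κ) (i : ι) :
    i ∈ blockRows rb k ↔ σ i ∈ S k := by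
  rw [← h]; simp [imageFamily]

/-- Restricting a permutation of the fibre to the blocks. [folklore] -/
def restrictFam {σ : Equiv.Perm ι} (h : imageFamily rb σ = S) (k : κ) :
    ↥(blockRows rb k) ≃ ↥(S k) :=
  σ.subtypeEquiv fun i => mem_iff_of_imageFamily_eq rb h k i

/-- **Laplace expansion of the permanent along a row partition** (Minc, *Permanents*, Ch. 2,
Thm. 1.2, iterated over the blocks of `rb`): `per A = ∑_S ∏_k per A[B_k, S_k]`, the sum over the
admissible column families `S`, the minors as sign-free bijection sums. [cite: Minc1978, Ch. 2, Thm. 1.2] -/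
theorem permanent_eq_sum_colFamilies (A : Matrix ι ι R) :
    A.permanent = ∑ S ∈ colFamilies rb, ∏ k, bijSum A (blockRows rb k) (S k) := by
  classical
  rw [← Literature.Combinatorics.Enumerative.sum_perm_prod_apply_eq_permanent,
    ← Finset.sum_fiberwise_of_maps_to (fun σ _ => imageFamily_mem rb σ)]
  refine Finset.sum_congr rfl fun S hS => ?_
  obtain ⟨hcard, hdisj⟩ := mem_colFamilies.1 hS
  simp only [bijSum]
  rw [Finset.prod_univ_sum]
  symm
  refine Finset.sum_bij' (fun β _ => glue rb hdisj β)
    (fun σ hσ => restrictFam rb (S := S) (Finset.mem_filter.1 hσ).2) ?_ ?_ ?_ ?_ ?_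
  · -- the glued permutation lies in the fibre
    intro β _
    refine Finset.mem_filter.2 ⟨Finset.mem_univ _, funext fun k => ?_⟩
    change (blockRows rb k).map (glue rb hdisj β).toEmbedding = S k
    apply Finset.eq_of_subset_of_card_le
    · intro x hx
      rw [Finset.mem_map] at hx
      obtain ⟨p, hp, rfl⟩ := hx
      simp only [Equiv.coe_toEmbedding, glue_apply]
      rw [glueFun_eq rb β hp]
      exact (β k ⟨p, hp⟩).2
    · rw [Finset.card_map, hcard k]
  · intro σ _
    exact Fintype.mem_piFinset.2 fun k => Finset.mem_univ _
  · -- restrict ∘ glue = id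
    intro β _
    funext k
    ext p
    simp only [restrictFam, Equiv.subtypeEquiv_apply, glue_apply]
    rw [glueFun_eq rb β p.2]
  · -- glue ∘ restrict = id
    intro σ hσ
    ext i
    simp [restrictFam, glueFun]
  · -- summands
    intro β _
    rw [← Finset.prod_fiberwise Finset.univ rb]
    refine Finset.prod_congr rfl fun k _ => ?_
    have hB : (Finset.univ.filter fun i => rb i = k) = blockRows rb k := rfl
    rw [hB, ← Finset.prod_coe_sort (blockRows rb k)]
    refine Finset.prod_congr rfl fun p _ => ?_
    rw [glue_apply, glueFun_eq rb β p.2]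

end BlockLaplace

end Summit.ValiantsHypothesis.ValiantsHypothesis.Theorems.BlockLaplaceExpansion
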